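import Mathlib
import Summits.ValiantsHypothesis.ValiantsHypothesis.Theses.GeneratorObstructions
import Summits.ValiantsHypothesis.ValiantsHypothesis.Theorems.GeneratorObstructionsGenInheritanceUpper
import Literature.Computability.AlgebraicComplexity.StandardFamiliesProofs

/-!
# Line `slice-overflow` — skeleton for the deciding crux `GeneratorObstructions.GenFlipThesis`
# (stmt-ValiantsHypothesis-11653, route-ValiantsHypothesis-GeneratorObstructions; crux-strategist, 2026-08-17)

**Idea.** The route derives `GenFlipThesis` from K1 = `PerGenDegreeSuperQP` (the permanent's algebra of
highest-weight vectors `A(Δ_m[per_m])`, per_m in its own `m²` variables, has minimal generators beyond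
every quasi-polynomial degree) and K2 = `PowGenDegreeQP` (inside the window
`m ≤ n = m + e ≤ 2^((log₂ m + c)^c)` EVERY generator type of `A(Δ_m[tr X^m])`, `X` of size `n`, has
quasi-polynomial degree), glued by degree overflow through inheritance (`CruxesToThesis`, proved).
The glue consumes K2 only at the INHERITED weights, and the landed inheritance theorem
(`GenInheritance.finrank_ne_zero_rename_of_strictMono`, helper file `…GenInheritanceUpper.lean`) says
exactly which weights these are: `χ` extended by zero along the FINAL SEGMENT `ι` of the lexicographic
order on `MatIdx n` (the last `m²` letters).  By inheritance such weights are the generator types of the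
`m²`-VARIABLE SLICE `E_{n,m} := Δ(tr X_n^m) ∩ Sym^m ℂ^{m²}` = the degree-`m` forms in `m²` variables
of border trace-power complexity `≤ n` — a `GL_{m²}`-variety in the SAME ambient space as `Δ(per_m)`.
So the trace-side obligation of the route can be cut down from all weights of `GL_{n²}` (K2) to the
slice (`stub_sliceGen` below): every subvariety of `Δ(tr X_n^m)` that uses many of the `n²` letters
(Chow varieties and subspace varieties in `n²` variables, polarisations) drops out, and what remains is
"the covariant algebra of the variety of qp-EASY `m²`-variate `m`-forms is generated in qp(`m`) degree"
— against K1's "the covariant algebra of `Δ(per_m)` is not".  The two stubs meet in the classical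
shape `μ(hard point) > μ(easy variety)` for the monotone invariant `μ` = generation degree of `A(·)`
(`GenPrinciple`: `A(Z) ↠ A(Y)` for `Y ⊆ Z`).

**Shape.** Two registered stubs: `stub_perLate` — the route's crux K1 VERBATIM (item
stmt-ValiantsHypothesis-11654, by name; staffed there, not new work) — and `stub_sliceGen` (NEW: K2
restricted to final-segment weights; strictly weaker than the route's K2, item 11655).  The inheritance
step with the explicit final-segment weight, `inheritFinal`, is PROVED here from the landed helper file
(`finrank_ne_zero_rename_of_strictMono` + transport between conjugate placements), and
`GenFlipThesis_of : GenFlipThesis` is the degree-overflow composition (sorry-free; `sorry` only inside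
the two `stub_*`).  Statements mention only Mathlib, `Literature.*` and the route file.

**Disproof used.** No `Disproof.lean` exists for this crux (`ledger crux ls`: no workfiles before this
seat).  Honoured kill lemma: `Theorems/GeneratorObstructionsNoGenFlipBeyondPolyKill.lean`
(`not_genFlipThesis_of_noGenFlipBeyondPoly`: a homogeneous no-go from a polynomial size on kills the
crux) — the line does not touch it (both stubs live at super-polynomial degree / quasi-polynomial size);
`NoGenFlipBeyondPoly` restricted to final-segment weights would kill THIS line at `stub_sliceGen`'s
partner exactly as it kills the route.  Negatives index (`ledger negatives --problem ValiantsHypothesis`):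
no refuted statement concerns generator types / `𝔪/𝔪²` of covariant algebras.
-/

namespace Summit.ValiantsHypothesis.ValiantsHypothesis.Cruxes.GenFlipThesis.SliceOverflow

open MvPolynomial
open Literature.NumberTheory.DiophantineGeometry Literature.Computability.AlgebraicComplexity
open Summit.ValiantsHypothesis.ValiantsHypothesis.Theses.GeneratorObstructions
open Summit.ValiantsHypothesis.ValiantsHypothesis.Theorems.GenInheritance

-- `Summit.ValiantsHypothesis.ValiantsHypothesis.…` is the tree's mandated single-conjunct layout.
set_option linter.dupNamespace false

/-! ## Stub 1 — the permanent side (route crux K1 = `PerGenDegreeSuperQP`, item 11654, verbatim) -/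

/-- **stub_perLate** = the route's crux `PerGenDegreeSuperQP` (stmt-ValiantsHypothesis-11654), by name:
for every `c, m₀` there are `m ≥ m₀` and a generator type `χ` of `A(Δ_m[per_m])` (per_m in its own `m²`
lexicographically ordered variables) of degree `-|χ|/m > 2^((log₂ m + c)^c)`.  Conjecture-grade (the
route's rank-2 crux); this line adds nothing to it and is staffed through the item. -/
theorem stub_perLate : PerGenDegreeSuperQP := by
  sorry

/-! ## Stub 2 — the trace side ON THE SLICE (new; weaker than the route's K2 = `PowGenDegreeQP`) -/

/-- **stub_sliceGen** (slice generation in the window): for every `c` there is `c₀` such that for all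
`1 ≤ m`, `n = m + e ≤ 2^((log₂ m + c)^c)`, the final-segment embedding `ι : MatIdx m → MatIdx n`
(strictly monotone onto an upper set — there is exactly one) and every weight `χ` of `GL_{m²}`:
if `χ` extended by zero along `ι` is a generator type of `A(Δ_m[tr X_n^m])` then its degree is
quasi-polynomial, `-|χ| ≤ m · 2^((log₂ m + c₀)^c₀)`.  By inheritance these are the generator types of
the covariant algebra of the slice `Δ(tr X_n^m) ∩ Sym^m ℂ^{m²}` (qp-easy `m²`-variate `m`-forms).
It is `PowGenDegreeQP` restricted to weights with at most `m²` nonzero parts.  Conjecture-grade.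
Why it might fail: the slice still contains the Chow variety `Ch_m(ℂ^{m²})` (`∏ ℓᵢ = m⁻¹ tr(C^m)`,
`C` cyclic, size `m`) and closures of small formulas; a super-quasi-polynomial generation degree of
`A(Ch_m(ℂ^{m²}))` = `N(T_m)`-invariants of the flag algebra of `GL_m` (Brion/Howe) kills it — and
would at the same time PROVE K1 (`Ch_m(ℂ^{m²}) ⊆ Δ(per_m)`), so that computation decides which
side of the route survives. -/
theorem stub_sliceGen :
    ∀ c : ℕ, ∃ c₀ : ℕ, ∀ m e : ℕ, 1 ≤ m → m + e ≤ 2 ^ ((Nat.log 2 m + c) ^ c) →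
      ∀ ι : MatIdx m → MatIdx (m + e), StrictMono ι → IsUpperSet (Set.range ι) →
        ∀ χ : Weight (MatIdx m),
          Module.finrank ℂ (↥(highestWeightSpace (orbitCoordRep (powFormLex ℂ (m + e) m) m) (Function.extend ι χ 0)) ⧸ Submodule.comap (highestWeightSpace (orbitCoordRep (powFormLex ℂ (m + e) m) m) (Function.extend ι χ 0)).subtype (⨆ p : Weight (MatIdx (m + e)) × Weight (MatIdx (m + e)), ⨆ (_ : p.1 + p.2 = (Function.extend ι χ 0) ∧ p.1 ≠ 0 ∧ p.2 ≠ 0), highestWeightSpace (orbitCoordRep (powFormLex ℂ (m + e) m) m) p.1 * highestWeightSpace (orbitCoordRep (powFormLex ℂ (m + e) m) m) p.2)) ≠ 0 →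
            -(Weight.size χ) ≤ (m : ℤ) * 2 ^ ((Nat.log 2 m + c₀) ^ c₀) := by
  sorry

/-! ## Glue lemma (PROVED): inheritance with the explicit final-segment weight -/

/-- **inheritFinal** (sorry-free): for `1 ≤ m` and every `e`, a generator type `χ` of `A(Δ_m[per_m])`
(own variables) yields the generator type `χ` EXTENDED BY ZERO ALONG THE FINAL SEGMENT `ι` of
`A(Δ_m[per_m^{(m+e)}])` (per_m on the top-left block of the `(m+e) × (m+e)` matrix variables).
This is the landed `GenInheritance.finrank_ne_zero_rename_of_strictMono` (χ ↦ `Function.extend ι χ 0`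
for the final-segment placement) transported to the block placement, which lies in the same
`GL_{(m+e)²}`-orbit (`rename_mem_glOrbit_rename_of_injective`,
`finrank_ne_zero_of_orbitVanishingIdeal_eq`) — i.e. the proof of `genInheritance_proof` with the
weight kept explicit. -/
theorem inheritFinal (m e : ℕ) (hm : 1 ≤ m) (χ : Weight (MatIdx m))
    (h : Module.finrank ℂ (↥(highestWeightSpace (orbitCoordRep (MvPolynomial.rename toLex (perPoly (Fin m) ℂ)) m) (χ)) ⧸ Submodule.comap (highestWeightSpace (orbitCoordRep (MvPolynomial.rename toLex (perPoly (Fin m) ℂ)) m) (χ)).subtype (⨆ p : Weight (MatIdx (m)) × Weight (MatIdx (m)), ⨆ (_ : p.1 + p.2 = (χ) ∧ p.1 ≠ 0 ∧ p.2 ≠ 0), highestWeightSpace (orbitCoordRep (MvPolynomial.rename toLex (perPoly (Fin m) ℂ)) m) p.1 * highestWeightSpace (orbitCoordRep (MvPolynomial.rename toLex (perPoly (Fin m) ℂ)) m) p.2)) ≠ 0) :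
    ∃ ι : MatIdx m → MatIdx (m + e), StrictMono ι ∧ IsUpperSet (Set.range ι) ∧
      Module.finrank ℂ (↥(highestWeightSpace (orbitCoordRep (MvPolynomial.rename (fun ij : Fin m × Fin m => toLex (Fin.castAdd e ij.1, Fin.castAdd e ij.2)) (perPoly (Fin m) ℂ)) m) (Function.extend ι χ 0)) ⧸ Submodule.comap (highestWeightSpace (orbitCoordRep (MvPolynomial.rename (fun ij : Fin m × Fin m => toLex (Fin.castAdd e ij.1, Fin.castAdd e ij.2)) (perPoly (Fin m) ℂ)) m) (Function.extend ι χ 0)).subtype (⨆ p : Weight (MatIdx (m + e)) × Weight (MatIdx (m + e)), ⨆ (_ : p.1 + p.2 = (Function.extend ι χ 0) ∧ p.1 ≠ 0 ∧ p.2 ≠ 0), highestWeightSpace (orbitCoordRep (MvPolynomial.rename (fun ij : Fin m × Fin m => toLex (Fin.castAdd e ij.1, Fin.castAdd e ij.2)) (perPoly (Fin m) ℂ)) m) p.1 * highestWeightSpace (orbitCoordRep (MvPolynomial.rename (fun ij : Fin m × Fin m => toLex (Fin.castAdd e ij.1, Fin.castAdd e ij.2)) (perPoly (Fin m) ℂ))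 m) p.2)) ≠ 0 := by
  have hm0 : m ≠ 0 := by omega
  have hf : (rename toLex (perPoly (Fin m) ℂ) : MvPolynomial (MatIdx m) ℂ).IsHomogeneous m := by
    simpa using (perPoly_isHomogeneous (n := Fin m) (k := ℂ)).rename_isHomogeneous
      (f := (toLex : Fin m × Fin m → MatIdx m))
  have hf0 : (rename toLex (perPoly (Fin m) ℂ) : MvPolynomial (MatIdx m) ℂ) ≠ 0 :=
    (map_ne_zero_iff _ (rename_injective _ toLex.injective)).mpr (perPoly_ne_zero (Fin m) ℂ)
  have hκ : Function.Injective fun x : MatIdx m =>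
      (toLex (Fin.castAdd e (ofLex x).1, Fin.castAdd e (ofLex x).2) : MatIdx (m + e)) := by
    intro x y hxy
    have h1 := toLex.injective hxy
    rw [Prod.mk.injEq] at h1
    exact ofLex.injective (Prod.ext (Fin.castAdd_injective _ _ h1.1) (Fin.castAdd_injective _ _ h1.2))
  obtain ⟨ι, hι, hup⟩ := exists_strictMono_isUpperSet (σ := MatIdx m) (τ := MatIdx (m + e))
    (Fintype.card_le_of_injective _ hκ)
  refine ⟨ι, hι, hup, ?_⟩
  have key := finrank_ne_zero_of_orbitVanishingIdeal_eq
    (orbitVanishingIdeal_eq_of_mem_glOrbit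
      (rename_mem_glOrbit_rename_of_injective _ ι hκ hι.injective
        (rename toLex (perPoly (Fin m) ℂ) : MvPolynomial (MatIdx m) ℂ)) m) hm0 _
    (finrank_ne_zero_rename_of_strictMono hι hup hf hf0 hm0 χ h)
  rw [rename_rename] at key
  exact key

/-! ## Composition (sorry-free): the crux from the two stubs -/

/-- **`GenFlipThesis` from the two stubs** (degree overflow on the slice): given `c, m₀`, take `c₀` from
`stub_sliceGen` at `c`, then `(m, χ)` from `stub_perLate` at exponent `c₀` beyond `max m₀ 1`; for
`n = m + e` in the window, `inheritFinal` makes `ext_ι χ` a generator type of the block permanent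
(`γ ≥ 1`); were `γ_{ext χ}(per_m) ≤ γ_{ext χ}(tr X^m)`, the trace side would have a generator of type
`ext_ι χ` ON THE SLICE, and `stub_sliceGen`'s bound `-|χ| ≤ m·2^((log₂ m + c₀)^c₀)` contradicts
`stub_perLate`'s `m·2^((log₂ m + c₀)^c₀) < -|χ|`. -/
theorem GenFlipThesis_of : GenFlipThesis := by
  intro c m₀
  obtain ⟨c₀, hc₀⟩ := stub_sliceGen c
  obtain ⟨m, hm, χ, hγ, hdeg⟩ := stub_perLate c₀ (max m₀ 1)
  have hm₀ : m₀ ≤ m := le_trans (le_max_left _ _) hm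
  have h1m : 1 ≤ m := le_trans (le_max_right _ _) hm
  refine ⟨m, hm₀, h1m, fun e he => ?_⟩
  obtain ⟨ι, hι, hup, hγ'⟩ := inheritFinal m e h1m χ hγ
  refine ⟨Function.extend ι χ 0, lt_of_not_ge fun hle => ?_⟩
  have hne := (Nat.lt_of_lt_of_le (Nat.pos_of_ne_zero hγ') hle).ne'
  have hb := hc₀ m e h1m he ι hι hup χ hne
  exact absurd (lt_of_lt_of_le hdeg hb) (lt_irrefl _)

end Summit.ValiantsHypothesis.ValiantsHypothesis.Cruxes.GenFlipThesis.SliceOverflow
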